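import Literature.Analysis.ValidatedNumerics.AffineArithmetic
import HarnessLib

/-!
# Fixed-point affine arithmetic: the reciprocal

Topic `Literature/Analysis/ValidatedNumerics`. The reciprocal of an affine form of
`AffineArithmetic.lean` (`AForm = ⟨c, a, r⟩` at scale `S`: `x·S = c + Σ_j a_j ε_j + e`,
`|e| ≤ r`, noise `ε_j ∈ [-1, 1]`), following the general recipe of de Figueiredo–Stolfi for a
non-affine operation: an affine approximation of it on the range of the argument plus a new error
term. For `1/x` on a provably POSITIVE form (`rad F < c`; negative forms are inverted after
`AForm.neg`) we take the tangent approximation at the centre `m = c` with the exact second-order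
remainder: with `ρ = rad F`, `X = x·S ∈ [m - ρ, m + ρ]`, `D = X - m = A + e` (`A` the linear part),
`x⁻¹·S = S²/X = S²/m - (S²/m²)D + S²D²/(m²X)` and `0 ≤ S²D²/(m²X) ≤ E := S²ρ²/(m²(m - ρ))`, hence
`x⁻¹·S ∈ (S²/m + E/2) - (S²/m²)A - (S²/m²)e ± E/2`; centre and coefficients are then rounded
down (errors `≤ 1` and `≤ |a|`, exactly as for `AForm.mul`) and the radius is
`⌈(S²/m²)r + E/2⌉ + 1 + |a|`. The intermediate quantities are exact rationals, so `inv` is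
kernel/`native_decide`-evaluable.

## Main definitions and results (namespace `Literature.Analysis.ValidatedNumerics`)

* `AForm.invErr S F = E`; `AForm.inv S F : Option AForm` (`none` unless `rad F < c`).
* `AForm.pos_of_rad_lt` (`rad F < c →` the form contains only positive reals),
  `AForm.rad_lt_of_inv`, **`AForm.mem_inv`**:
  `inv S F = some G → mem S ε x F → mem S ε x⁻¹ G` (valid noise, `0 < S`).

## References

* L. H. de Figueiredo, J. Stolfi, *Affine arithmetic: concepts and applications*, Numer.
  Algorithms 37 (2004) 147–158, §3 (non-affine operations). [FigueiredoStolfi2004]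
-/

open Finset

namespace Literature.Analysis.ValidatedNumerics

namespace AForm

variable {S : ℕ} {ε : ℕ → ℝ} {x : ℝ} {F : AForm}

/-- The second-order remainder bound `E = S²ρ²/(m²(m - ρ))` of the reciprocal (`m = c`,
`ρ = rad F`; meaningful when `ρ < m`). [cite: FigueiredoStolfi2004, §3] -/
def invErr (S : ℕ) (F : AForm) : ℚ :=
  (S : ℚ) ^ 2 * (rad F : ℚ) ^ 2 / ((F.c : ℚ) ^ 2 * ((F.c : ℚ) - rad F))

/-- Reciprocal at scale `S` of a provably positive form (`none` unless `rad F < c`): centre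
`⌊S²/m + E/2⌋`, coefficients `⌊-(S²/m²)a_j⌋`, radius `⌈(S²/m²)r + E/2⌉ + 1 + |a|` (see the
module docstring for the derivation). [cite: FigueiredoStolfi2004, §3] -/
def inv (S : ℕ) (F : AForm) : Option AForm :=
  if (rad F : ℤ) < F.c then
    some ⟨⌊(S : ℚ) ^ 2 / F.c + invErr S F / 2⌋,
      F.a.map fun b : ℤ => ⌊-((S : ℚ) ^ 2 / (F.c : ℚ) ^ 2 * b)⌋,
      ⌈(S : ℚ) ^ 2 / (F.c : ℚ) ^ 2 * F.r + invErr S F / 2⌉₊ + 1 + F.a.length⟩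
  else none

/-- The natural ceiling of a rational bounds it from above, read in `ℝ`. [folklore] -/
theorem le_natCeil (q : ℚ) {t : ℝ} (ht : (q : ℝ) = t) : t ≤ ((⌈q⌉₊ : ℕ) : ℝ) := by
  subst ht
  exact_mod_cast Nat.le_ceil q

/-- A form whose total deviation is below its centre contains only positive reals (valid noise,
`0 < S`). [cite: FigueiredoStolfi2004, §2] -/
theorem pos_of_rad_lt (hS : 0 < S) (hε : Valid ε) (hlt : (rad F : ℤ) < F.c) (hx : mem S ε x F) :
    0 < x := by
  have h := (abs_le.1 (abs_sub_le_rad hε hx)).1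
  have hlt' : ((rad F : ℕ) : ℝ) < F.c := by exact_mod_cast hlt
  have hSr : (0 : ℝ) < S := by exact_mod_cast hS
  have hX : 0 * (S : ℝ) < x * S := by rw [zero_mul]; linarith
  exact lt_of_mul_lt_mul_right hX hSr.le

/-- `inv` answers only on forms with `rad F < c`. [folklore] -/
theorem rad_lt_of_inv {G : AForm} (h : inv S F = some G) : (rad F : ℤ) < F.c := by
  unfold inv at h
  split_ifs at h with hlt
  exact hlt

/-- **Inclusion theorem of the affine reciprocal.** [cite: FigueiredoStolfi2004, §3] -/
theorem mem_inv (hS : 0 < S) (hε : Valid ε) {G : AForm} (hG : inv S F = some G)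
    (hx : mem S ε x F) : mem S ε x⁻¹ G := by
  have hlt := rad_lt_of_inv hG
  have hx0 : x ≠ 0 := (pos_of_rad_lt hS hε hlt hx).ne'
  have hrad := abs_le.1 (abs_sub_le_rad hε hx)
  rw [inv, if_pos hlt, Option.some.injEq] at hG
  subst hG
  simp only [mem] at hx ⊢
  have hSr : (0 : ℝ) < S := by exact_mod_cast hS
  have hρm : ((rad F : ℕ) : ℝ) < F.c := by exact_mod_cast hlt
  have hρ0 : (0 : ℝ) ≤ rad F := Nat.cast_nonneg _
  have hlo : (F.c : ℝ) - rad F ≤ x * S := by linarith [hrad.1]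
  have hX : 0 < x * S := by linarith
  have hm : (0 : ℝ) < F.c := by linarith
  have hc0 : (F.c : ℝ) ≠ 0 := hm.ne'
  obtain ⟨e, he⟩ : ∃ e, x * S = F.c + lin ε F.a + e := ⟨x * S - (F.c + lin ε F.a), by ring⟩
  have he' : |e| ≤ F.r := by convert hx using 2; linarith
  -- second-order expansion of `S²/X` about the centre
  set T : ℝ := (S : ℝ) ^ 2 * (x * S - F.c) ^ 2 / ((F.c : ℝ) ^ 2 * (x * S)) with hT
  set E : ℝ := (S : ℝ) ^ 2 * (rad F : ℝ) ^ 2 / ((F.c : ℝ) ^ 2 * ((F.c : ℝ) - rad F)) with hE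
  have hexp : x⁻¹ * S
      = (S : ℝ) ^ 2 / F.c - (S : ℝ) ^ 2 / (F.c : ℝ) ^ 2 * (x * S - F.c) + T := by
    rw [hT]; field_simp; ring
  have hT0 : 0 ≤ T := by rw [hT]; positivity
  have hTE : T ≤ E := by
    rw [hT, hE]
    refine div_le_div₀ (by positivity) ?_ (mul_pos (by positivity) (by linarith)) ?_
    · exact mul_le_mul_of_nonneg_left (sq_le_sq' hrad.1 hrad.2) (by positivity)
    · exact mul_le_mul_of_nonneg_left hlo (by positivity)
  -- the three roundings
  have hcen : |(S : ℝ) ^ 2 / F.c + E / 2 - ((⌊(S : ℚ) ^ 2 / F.c + invErr S F / 2⌋ : ℤ) : ℝ)|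
      ≤ 1 := by
    rw [abs_sub_comm]; exact abs_floor_sub_le _ (by rw [hE]; push_cast [invErr]; ring)
  have hlin : |-((S : ℝ) ^ 2 / (F.c : ℝ) ^ 2) * lin ε F.a
      - lin ε (F.a.map fun b : ℤ => ⌊-((S : ℚ) ^ 2 / (F.c : ℚ) ^ 2 * b)⌋)| ≤ F.a.length := by
    rw [abs_sub_comm]
    exact abs_lin_map_sub_le (g := fun b : ℤ => ⌊-((S : ℚ) ^ 2 / (F.c : ℚ) ^ 2 * b)⌋)
      (t := -((S : ℝ) ^ 2 / (F.c : ℝ) ^ 2)) (fun b => abs_floor_sub_le _ (by push_cast; ring))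
      hε F.a
  have hceil : (S : ℝ) ^ 2 / (F.c : ℝ) ^ 2 * F.r + E / 2
      ≤ ((⌈(S : ℚ) ^ 2 / (F.c : ℚ) ^ 2 * F.r + invErr S F / 2⌉₊ : ℕ) : ℝ) :=
    le_natCeil _ (by rw [hE]; push_cast [invErr]; ring)
  have h4 : |-((S : ℝ) ^ 2 / (F.c : ℝ) ^ 2) * e| ≤ (S : ℝ) ^ 2 / (F.c : ℝ) ^ 2 * F.r := by
    rw [neg_mul, abs_neg, abs_mul, abs_of_nonneg (by positivity)]
    exact mul_le_mul_of_nonneg_left he' (by positivity)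
  have h5 : |T - E / 2| ≤ E / 2 := by rw [abs_le]; constructor <;> linarith
  -- assembly
  have eq : x⁻¹ * S - (((⌊(S : ℚ) ^ 2 / F.c + invErr S F / 2⌋ : ℤ) : ℝ)
      + lin ε (F.a.map fun b : ℤ => ⌊-((S : ℚ) ^ 2 / (F.c : ℚ) ^ 2 * b)⌋))
      = ((S : ℝ) ^ 2 / F.c + E / 2 - ((⌊(S : ℚ) ^ 2 / F.c + invErr S F / 2⌋ : ℤ) : ℝ))
        + (-((S : ℝ) ^ 2 / (F.c : ℝ) ^ 2) * lin ε F.a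
            - lin ε (F.a.map fun b : ℤ => ⌊-((S : ℚ) ^ 2 / (F.c : ℚ) ^ 2 * b)⌋))
        + -((S : ℝ) ^ 2 / (F.c : ℝ) ^ 2) * e + (T - E / 2) := by
    rw [hexp, show x * S - F.c = lin ε F.a + e by rw [he]; ring]; ring
  rw [Nat.cast_add, Nat.cast_add, Nat.cast_one, eq]
  refine ((abs_add_le _ _).trans (add_le_add (abs_add_three _ _ _) le_rfl)).trans ?_
  linarith

/-- `1/x` for `x = 2 + ε₀/2` at scale `2^10`: `(533 - 128 ε₀ ± 24)/1024 ⊇ [0.4, 2/3]`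
(kernel evaluation of the rational roundings). -/
example : inv 1024 (var 2048 512 0) = some ⟨533, [-128], 24⟩ := by decide +kernel

/-- A form that may vanish (`x = (1 + ε₀)/2`) has no reciprocal. -/
example : inv 1024 (var 512 512 0) = none := by decide +kernel

end AForm

end Literature.Analysis.ValidatedNumerics
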